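import Literature.Computability.Complexity.ListFoldBricks
import Literature.Computability.Complexity.FoldBricks
import Literature.Computability.Complexity.IterateFPPoly
import Literature.Computability.Complexity.HashBricks
import Literature.Computability.Complexity.UnaryLeBinary
import Literature.Computability.Complexity.CountingHierarchyProofs
import HarnessLib

/-!
# Typed polynomial time on codes: an algebra of `FP` maps between encoded types

Trunk `CplxCore`, toolkit above the brick algebra (`BrickAlgebra.lean`, `ListFoldBricks.lean`,
`IterateFPPoly.lean`, `HashBricks.lean`, `FPStringBricks.lean`, `StackBricks*.lean`). The bricks are
total string functions `List Bool → List Bool` with membership in `FP` and a value on *every* string;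
a Karp reduction between encoded problems, however, is specified only on genuine codes:
`∃ f ∈ FP, ∀ a, f (code a) = code (g a)` for a mathematical map `g : α → β`. This file packages that
datum as the predicate `CodeFP eα eβ g` on a pair of encoders `eα : α → List Bool`, `eβ : β → List Bool`
and proves it closed under the operations functional programs are written in, so that the
polynomial-time computability of an instance map given by an explicit functional program (lists,
numerals, tests, bounded loops) is assembled from typed combinators with no machine, transducer or
growth estimate written at the use site (first client: the Dinur–Safra instance map of Hirahara's
Thm. 5.2, `CSPToCMMSAMachine.lean`).

* Encoders: `natE` (binary, `encodeNat`), `unE` (unary), `bitE`, `pairE` (`boolPair`), `rawE e l =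
  encList (l.map e)` (nested pairs, the format the list bricks read) and `listE e l = ⟨1^{|l|}, rawE e l⟩`;
  `natE_eq`, `pairE_eq`, `listE_eq`, … identify them with the `encode` fields of Mathlib's
  `encodingNatBool`, `unaryEncodingNat`, `encodingBoolBool` and the tree's `Encoding.pairBool`,
  `Encoding.listBool` (`BoolEncodings.lean`), so that a `CodeFP` statement between the tuple codes of
  two problems is literally the `∃ f ∈ FP, …` clause of a Karp reduction.
* Structure: `comp`, `pair`, `fst`, `snd`, `const`, `ite` (on a computed bit), `and`/`or`/`not`,
  `eq`/`beq` (equality through equality of codes, for injective codes), `congr`, `recodeOut`.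
* Numerals: `natAdd`, `natSub`, `natMul`, `natLt`, `natLe`, `natEq` (bricks `addFn`, `subFn`, `prodFn`,
  `ltFn`, `eqPairFn`), `unSucc`, `unAdd`, `natOfUn` (`lenBinF`), `unLeNat`/`natLeUn` (`unLeBinFn`),
  `unOfNatMin` (`binToUnaryFn`; the uncapped binary-to-unary conversion is not polynomial).
* Lists: `rawOfList`/`listOfRaw` (drop / recompute the unary length header), `rawCons`, `rawIsEmpty`,
  `rawHeadD`, `rawTail`, `rawAppend`, `rawSingleton`, `rawCases`; the **fold** `foldl` — a left fold with
  a context, for a step computed on codes and an accumulator whose code is polynomially bounded in the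
  whole input along the run (the one hypothesis the user discharges; realised by `Brick.foldFn` with the
  step capped at that bound, `capF`, which makes the clocked-iteration lemma
  `iterate_mem_FP_of_growth_poly` applicable on every string, `foldFn_mem_FP_of_le`); and its
  consequences with the bound discharged once and for all: `ulength`/`natLength`, `map`/`map₀` (bound
  from the output-length polynomial of the item map, `exists_poly_length_le_of_mem_FP`), `all`, `any`,
  `mem`, `nodup`, `flatten`, `zipWith`, `brange` (`(l, n) ↦ [0, …, min n |l| - 1]`: a list serves as the
  unary budget of a loop over a binary bound), `rawGetD` (indexing by a binary numeral, `nthItemFn`).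

## Design notes

* Encoders are bare functions, not `Computability.Encoding` structures: only `encode` enters a
  `CodeFP` statement, and intermediate formats (`rawE`, unary counters) need no decoder.
* Every combinator's specification is an equation between mathematical maps; the string level
  (records, `fstF`/`sndF`, one-bit conditions) is confined to the proofs of this file.
* `mem` is stated with the `BEq`-based decidability of list membership and `nodup` with
  `List.nodupDecidable`, the instances `decide` synthesizes at concrete item types, so that use-site
  ascriptions unify syntactically.
* Not here: division with remainder on numerals (`divFn`/`remFn` exist as bricks), sorting
  (`isortFn`), maps between different list formats other than `rawOfList`/`listOfRaw`.

## References

* S. Arora, B. Barak, *Computational Complexity: A Modern Approach*, CUP 2009, §1.2–1.3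
  (polynomial-time computable functions; closure under composition and polynomially bounded loops;
  representation independence), §0.1 (codes of tuples and lists), §2.1 (Karp reductions).
-/

namespace Literature.Computability.Complexity

open _root_.Computability Polynomial Brick

/-- **`CodeFP eα eβ g`: the map `g : α → β` is computed on codes by a polynomial-time string
function** — some `f ∈ FP` satisfies `f (eα a) = eβ (g a)` for every `a : α` (nothing is asked
off the image of `eα`). With `eα`, `eβ` the `encode` fields of Boolean encodings this is exactly
the datum of a polynomial-time computable map between the encoded types in the sense used by the
tree's Karp reductions (`∃ f ∈ FP, ∀ a, f (code a) = code (g a)`). [cite: AroraBarak2009, §1.2–1.3 (polynomial-time computable functions, representation independence)] -/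
def CodeFP {α β : Type} (eα : α → List Bool) (eβ : β → List Bool) (g : α → β) : Prop :=
  ∃ f ∈ FP, ∀ a, f (eα a) = eβ (g a)

namespace CodeFP

/-! ### Encoders -/

/-- Binary numerals (Mathlib's `encodeNat`, the `encode` of `encodingNatBool`). [folklore] -/
abbrev natE : ℕ → List Bool := encodeNat

/-- Unary numerals (Mathlib's `unaryEncodeNat`). [folklore] -/
abbrev unE : ℕ → List Bool := unaryEncodeNat

/-- Bits as one-symbol strings (Mathlib's `encodeBool`). [folklore] -/
def bitE : Bool → List Bool := fun b => [b]

/-- Pairs: `boolPair` of the component codes (the `encode` of `Encoding.pairBool`). [folklore] -/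
def pairE {α β : Type} (eα : α → List Bool) (eβ : β → List Bool) : α × β → List Bool :=
  fun p => boolPair (eα p.1) (eβ p.2)

/-- Raw lists: nested pairs of the item codes, `encList` (no length header). [folklore] -/
def rawE {α : Type} (e : α → List Bool) : List α → List Bool := fun l => encList (l.map e)

/-- Lists with a unary length header (the `encode` of `Encoding.listBool`, `listE_eq`). [folklore] -/
def listE {α : Type} (e : α → List Bool) : List α → List Bool :=
  fun l => boolPair (unE l.length) (rawE e l)

variable {α β γ δ σ : Type}

/-- Unfolding of `pairE`. [folklore] -/
@[simp] theorem pairE_apply (eα : α → List Bool) (eβ : β → List Bool) (p : α × β) :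
    pairE eα eβ p = boolPair (eα p.1) (eβ p.2) := rfl

/-- The raw code of the empty list is `ε`. [folklore] -/
@[simp] theorem rawE_nil (e : α → List Bool) : rawE e [] = [] := rfl

/-- The raw code of a cons is the pair of the head code and the tail code. [folklore] -/
@[simp] theorem rawE_cons (e : α → List Bool) (a : α) (l : List α) :
    rawE e (a :: l) = boolPair (e a) (rawE e l) := rfl

/-- Unary numerals are blocks of `1`s. [folklore] -/
theorem unE_eq_ones (n : ℕ) : unE n = ones n := by
  induction n with
  | zero => rfl
  | succ n ih => simp [unE, unaryEncodeNat, ih, ones, List.replicate_succ]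

/-- `|1ⁿ| = n`. [folklore] -/
@[simp] theorem length_unE (n : ℕ) : (unE n).length = n := by
  rw [unE_eq_ones]; simp

/-- `bitsToNat` reads binary numerals. [folklore] -/
@[simp] theorem bitsToNat_natE (n : ℕ) : bitsToNat (natE n) = n := bitsToNat_encodeNat n

/-- `0` is coded by `ε`. [folklore] -/
@[simp] theorem natE_zero : natE 0 = [] := rfl

/-- Binary numerals are injective. [folklore] -/
theorem natE_injective : Function.Injective natE := fun a b h => by
  simpa using congrArg bitsToNat h

/-- Unary numerals are injective. [folklore] -/
theorem unE_injective : Function.Injective unE := fun a b h => by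
  simpa using congrArg List.length h

/-- Bit codes are injective. [folklore] -/
theorem bitE_injective : Function.Injective bitE := fun a b h => by
  simpa [bitE] using h

/-- Pair codes of injective codes are injective. [folklore] -/
theorem pairE_injective {eα : α → List Bool} {eβ : β → List Bool} (hα : Function.Injective eα)
    (hβ : Function.Injective eβ) : Function.Injective (pairE eα eβ) := by
  rintro ⟨a, b⟩ ⟨a', b'⟩ h
  have h' := congrArg boolUnpair h
  simp only [pairE_apply, boolUnpair_boolPair, Prod.mk.injEq] at h'
  rw [hα h'.1, hβ h'.2]

/-- `decNil` reads raw codes. [folklore] -/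
@[simp] theorem decNil_rawE (e : α → List Bool) (l : List α) : decNil (rawE e l) = l.map e :=
  decNil_encList _

/-- Raw list codes of an injective code are injective. [folklore] -/
theorem rawE_injective {e : α → List Bool} (he : Function.Injective e) :
    Function.Injective (rawE e) := fun l l' h => by
  have := congrArg decNil h
  simp only [decNil_rawE] at this
  exact List.map_injective_iff.2 he this

/-- Headed list codes of an injective code are injective. [folklore] -/
theorem listE_injective {e : α → List Bool} (he : Function.Injective e) :
    Function.Injective (listE e) := fun l l' h => by
  have := congrArg boolUnpair h
  simp only [listE, boolUnpair_boolPair, Prod.mk.injEq] at this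
  exact rawE_injective he this.2

/-- The raw code of a concatenation is the concatenation of the raw codes. [folklore] -/
theorem rawE_append (e : α → List Bool) (l₁ l₂ : List α) :
    rawE e (l₁ ++ l₂) = rawE e l₁ ++ rawE e l₂ := by
  induction l₁ with
  | nil => rfl
  | cons a l ih => simp [ih, boolPair]

/-- Length of a raw code. [folklore] -/
theorem length_rawE (e : α → List Bool) (l : List α) :
    (rawE e l).length = (l.map fun a => 2 * (e a).length + 2).sum := by
  rw [rawE, length_encList, List.map_map]; rfl

/-- A raw code is at least as long as the list. [folklore] -/
theorem length_le_length_rawE (e : α → List Bool) (l : List α) : l.length ≤ (rawE e l).length := by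
  induction l with
  | nil => simp
  | cons a l ih => rw [rawE_cons, length_boolPair, List.length_cons]; omega

/-- Every item is short in the raw code of its list: `2|e a| + 2 ≤ |rawE e l|`. [folklore] -/
theorem length_item_le_length_rawE (e : α → List Bool) {l : List α} {a : α} (h : a ∈ l) :
    2 * (e a).length + 2 ≤ (rawE e l).length := by
  rw [length_rawE]
  exact List.single_le_sum (fun _ _ => Nat.zero_le _) _ (List.mem_map.2 ⟨a, h, rfl⟩)

/-- Raw codes are monotone along sublists. [folklore] -/
theorem length_rawE_le_of_sublist (e : α → List Bool) {l₁ l₂ : List α} (h : l₁.Sublist l₂) :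
    (rawE e l₁).length ≤ (rawE e l₂).length := by
  rw [length_rawE, length_rawE]
  exact List.Sublist.sum_le_sum (h.map _) fun _ _ => Nat.zero_le _

/-! ### Bridges to Mathlib encodings -/

/-- `encodingNatBool` codes by `natE` (definitional). [folklore] -/
theorem natE_eq : (encodingNatBool.encode : ℕ → List Bool) = natE := rfl

/-- `unaryEncodingNat` codes by `unE` (definitional). [folklore] -/
theorem unE_eq : (unaryEncodingNat.encode : ℕ → List Bool) = unE := rfl

/-- `encodingBoolBool` codes by `bitE` (definitional). [folklore] -/
theorem bitE_eq : (encodingBoolBool.encode : Bool → List Bool) = bitE := rfl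

/-- `Encoding.pairBool` codes by `pairE` (definitional). [folklore] -/
theorem pairE_eq (ea : Encoding α Bool) (eb : Encoding β Bool) :
    ((ea.pairBool eb).encode : α × β → List Bool) = pairE ea.encode eb.encode := rfl

/-- `Encoding.listBool` codes by `listE`. [folklore] -/
theorem listE_eq (ea : Encoding α Bool) : (ea.listBool.encode : List α → List Bool) = listE ea.encode := by
  funext l
  change boolPair (unaryEncodeNat l.length) (l.foldr (fun a acc => boolPair (ea.encode a) acc) []) = _
  simp only [listE, unE, rawE]
  congr 1
  induction l with
  | nil => rfl
  | cons a l ih => simp [encList_cons, ih]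

/-! ### Structural combinators -/

variable {eα : α → List Bool} {eβ : β → List Bool} {eγ : γ → List Bool} {eδ : δ → List Bool}
  {eσ : σ → List Bool}

/-- Extensionality in the computed map. [folklore] -/
theorem congr {g g' : α → β} (h : CodeFP eα eβ g) (hg : ∀ a, g a = g' a) : CodeFP eα eβ g' := by
  obtain ⟨f, hf, hfg⟩ := h
  exact ⟨f, hf, fun a => by rw [hfg, hg]⟩

/-- A string function that is already in `FP` and commutes with the codes. [folklore] -/
theorem of_fn {g : α → β} (f : List Bool → List Bool) (hf : f ∈ FP) (h : ∀ a, f (eα a) = eβ (g a)) :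
    CodeFP eα eβ g := ⟨f, hf, h⟩

/-- Identity. [folklore] -/
protected theorem id (eα : α → List Bool) : CodeFP eα eα id :=
  ⟨id, PolyTimeComputable.id _, fun _ => rfl⟩

/-- **A map computed on codes is polynomial-time computable between the encoders** in the sense of
`TimeBounds.lean` (the machine of the string function, run on codes). The converse needs a clock
(a machine for `g` may diverge off the image of `eα`) and is not used. [cite: AroraBarak2009, §1.2–1.3] -/
theorem polyTimeComputable {g : α → β} (h : CodeFP eα eβ g) : PolyTimeComputable eα eβ g := by
  obtain ⟨F, ⟨p, M, hM⟩, hFg⟩ := h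
  exact ⟨p, M, fun a => by simpa [hFg] using hM (eα a)⟩


/-- Change of code computed by the identity string function (e.g. `listE e ↦` its parts). [folklore] -/
theorem recode {eα' : α → List Bool} (h : ∀ a, eα a = eα' a) : CodeFP eα eα' id :=
  ⟨id, PolyTimeComputable.id _, fun a => h a⟩

/-- Composition. [cite: AroraBarak2009, §1.3 (composition of polynomial-time functions)] -/
theorem comp {g : α → β} {h : β → γ} (hh : CodeFP eβ eγ h) (hg : CodeFP eα eβ g) :
    CodeFP eα eγ (fun a => h (g a)) := by
  obtain ⟨F, hF, hFg⟩ := hg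
  obtain ⟨H, hH, hHh⟩ := hh
  exact ⟨H ∘ F, comp_mem_FP hH hF, fun a => by rw [Function.comp_apply, hFg, hHh]⟩

/-- Constants. [folklore] -/
theorem const (eα : α → List Bool) {eβ : β → List Bool} (b : β) : CodeFP eα eβ (fun _ => b) :=
  ⟨fun _ => eβ b, const_mem_FP _, fun _ => rfl⟩

/-- Pairing of two computed maps. [folklore] -/
theorem pair {g : α → β} {h : α → γ} (hg : CodeFP eα eβ g) (hh : CodeFP eα eγ h) :
    CodeFP eα (pairE eβ eγ) (fun a => (g a, h a)) := by
  obtain ⟨F, hF, hFg⟩ := hg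
  obtain ⟨H, hH, hHh⟩ := hh
  exact ⟨fanoutFn F H, fanoutFn_mem_FP hF hH, fun a => by simp [hFg, hHh]⟩

/-- First projection. [folklore] -/
theorem fst (eα : α → List Bool) (eβ : β → List Bool) : CodeFP (pairE eα eβ) eα Prod.fst :=
  ⟨fstF, fstF_mem_FP, fun p => by simp⟩

/-- Second projection. [folklore] -/
theorem snd (eα : α → List Bool) (eβ : β → List Bool) : CodeFP (pairE eα eβ) eβ Prod.snd :=
  ⟨sndF, sndF_mem_FP, fun p => by simp⟩

/-- Composition with a pair of arguments. [folklore] -/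
theorem comp₂ {g : α → β} {h : α → γ} {k : β × γ → δ} (hk : CodeFP (pairE eβ eγ) eδ k)
    (hg : CodeFP eα eβ g) (hh : CodeFP eα eγ h) : CodeFP eα eδ (fun a => k (g a, h a)) :=
  hk.comp (hg.pair hh)

/-- First component of a computed pair. [folklore] -/
theorem fst' {g : α → β × γ} (hg : CodeFP eα (pairE eβ eγ) g) : CodeFP eα eβ (fun a => (g a).1) :=
  (fst eβ eγ).comp hg

/-- Second component of a computed pair. [folklore] -/
theorem snd' {g : α → β × γ} (hg : CodeFP eα (pairE eβ eγ) g) : CodeFP eα eγ (fun a => (g a).2) :=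
  (snd eβ eγ).comp hg

/-- **Branching on a computed bit.** [cite: AroraBarak2009, §1.3] -/
theorem ite {p : α → Bool} {g h : α → β} (hp : CodeFP eα bitE p) (hg : CodeFP eα eβ g)
    (hh : CodeFP eα eβ h) : CodeFP eα eβ (fun a => if p a then g a else h a) := by
  obtain ⟨C, hC, hCp⟩ := hp
  obtain ⟨F, hF, hFg⟩ := hg
  obtain ⟨H, hH, hHh⟩ := hh
  refine ⟨iteFn C F H, iteFn_mem_FP hC hF hH, fun a => ?_⟩
  rw [iteFn_apply (b := p a) (by rw [hCp]; rfl)]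
  dsimp only
  cases p a <;> simp [hFg, hHh]

/-- Conjunction of computed bits. [folklore] -/
theorem and {p q : α → Bool} (hp : CodeFP eα bitE p) (hq : CodeFP eα bitE q) :
    CodeFP eα bitE (fun a => p a && q a) :=
  (hp.ite hq (const eα false)).congr fun a => by cases p a <;> simp

/-- Disjunction of computed bits. [folklore] -/
theorem or {p q : α → Bool} (hp : CodeFP eα bitE p) (hq : CodeFP eα bitE q) :
    CodeFP eα bitE (fun a => p a || q a) :=
  (hp.ite (const eα true) hq).congr fun a => by cases p a <;> simp

/-- Negation of a computed bit. [folklore] -/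
theorem not {p : α → Bool} (hp : CodeFP eα bitE p) : CodeFP eα bitE (fun a => !p a) :=
  (hp.ite (const eα false) (const eα true)).congr fun a => by cases p a <;> simp

/-- Equality of codes decides equality, for an injective code. [cite: AroraBarak2009, §1.3] -/
theorem eq [DecidableEq α] (he : Function.Injective eα) :
    CodeFP (pairE eα eα) bitE (fun p => decide (p.1 = p.2)) :=
  ⟨eqPairFn, eqPairFn_mem_FP, fun p => by
    rw [pairE_apply, eqPairFn_boolPair]
    simp [he.eq_iff, bitE]⟩

/-- Equality of codes is Boolean equality, for an injective code and a lawful `BEq`. [cite: AroraBarak2009, §1.3] -/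
theorem beq [BEq α] [LawfulBEq α] (he : Function.Injective eα) :
    CodeFP (pairE eα eα) bitE (fun p => p.1 == p.2) :=
  ⟨eqPairFn, eqPairFn_mem_FP, fun p => by
    change _ = [p.1 == p.2]
    rw [pairE_apply, eqPairFn_boolPair]
    congr 1
    rw [Bool.eq_iff_iff, decide_eq_true_iff, beq_iff_eq, he.eq_iff]⟩

/-! ### Numerals -/

/-- Addition of binary numerals. [folklore] -/
theorem natAdd : CodeFP (pairE natE natE) natE (fun p => p.1 + p.2) :=
  ⟨addFn, addFn_mem_FP, fun p => by simp⟩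

/-- Truncated subtraction of binary numerals. [folklore] -/
theorem natSub : CodeFP (pairE natE natE) natE (fun p => p.1 - p.2) :=
  ⟨subFn, subFn_mem_FP, fun p => by simp⟩

/-- Multiplication of binary numerals. [folklore] -/
theorem natMul : CodeFP (pairE natE natE) natE (fun p => p.1 * p.2) :=
  ⟨prodFn, prodFn_mem_FP, fun p => by simp⟩

/-- Strict comparison of binary numerals. [folklore] -/
theorem natLt : CodeFP (pairE natE natE) bitE (fun p => decide (p.1 < p.2)) :=
  ⟨ltFn, ltFn_mem_FP, fun p => by simp [bitE]⟩

/-- Comparison of binary numerals. [folklore] -/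
theorem natLe : CodeFP (pairE natE natE) bitE (fun p => decide (p.1 ≤ p.2)) :=
  ((natLt.comp ((snd natE natE).pair (fst natE natE))).not).congr fun p => by
    by_cases h : p.1 ≤ p.2
    · simp [h]
    · simp [h, Nat.lt_of_not_le h]

/-- Equality of binary numerals. [folklore] -/
theorem natEq : CodeFP (pairE natE natE) bitE (fun p => decide (p.1 = p.2)) := eq natE_injective

/-- Successor in unary: prepend a `1`. [folklore] -/
theorem unSucc : CodeFP unE unE (· + 1) := ⟨List.cons true, cons_mem_FP true, fun _ => rfl⟩

/-- Addition in unary: concatenation. [folklore] -/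
theorem unAdd : CodeFP (pairE unE unE) unE (fun p => p.1 + p.2) :=
  ⟨fun z => fstF z ++ sndF z, append_mem_FP fstF_mem_FP sndF_mem_FP, fun p => by
    simp [unE_eq_ones, ones]⟩

/-- Unary to binary. [folklore] -/
theorem natOfUn : CodeFP unE natE id :=
  ⟨lenBinF, lenBinF_mem_FP, fun n => by simp⟩

/-- `1ᵏ ≤ n` for unary `k` and binary `n`. [folklore] -/
theorem unLeNat : CodeFP (pairE unE natE) bitE (fun p => decide (p.1 ≤ p.2)) :=
  ⟨unLeBinFn, unLeBinFn_mem_FP, fun p => by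
    rw [pairE_apply, show natE p.2 = encodeNat p.2 from rfl, unLeBinFn_boolPair, length_unE]; rfl⟩

/-- Binary to unary, capped by a unary bound: `(k, n) ↦ min n k`. (The uncapped conversion is
not polynomial.) [folklore] -/
theorem unOfNatMin : CodeFP (pairE unE natE) unE (fun p => min p.2 p.1) :=
  ⟨binToUnaryFn, binToUnaryFn_mem_FP, fun p => by
    rw [pairE_apply, binToUnaryFn_boolPair, bitsToNat_natE, length_unE, unE_eq_ones]⟩

/-! ### Raw lists: constructors and destructors -/

/-- The items of a headed list (drop the unary length header). [folklore] -/
theorem rawOfList (e : α → List Bool) : CodeFP (listE e) (rawE e) id :=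
  ⟨sndF, sndF_mem_FP, fun l => by simp [listE]⟩

/-- `cons` on raw lists is the identity on codes. [folklore] -/
theorem rawCons (e : α → List Bool) : CodeFP (pairE e (rawE e)) (rawE e) (fun p => p.1 :: p.2) :=
  ⟨id, PolyTimeComputable.id _, fun _ => rfl⟩

/-- Emptiness test on raw lists. [folklore] -/
theorem rawIsEmpty (e : α → List Bool) : CodeFP (rawE e) bitE List.isEmpty :=
  ⟨isNilFn, isNilFn_mem_FP, fun l => by
    cases l with
    | nil => simp [isNilFn, bitE]
    | cons a l =>
      have h : boolPair (e a) (rawE e l) ≠ [] := fun h => by simpa using congrArg List.length h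
      simp [isNilFn, bitE, h]⟩

/-- Head of a raw list, provided the default is coded by `ε` (as `0` is by `natE`). [folklore] -/
theorem rawHeadD (e : α → List Bool) {d : α} (hd : e d = []) : CodeFP (rawE e) e (fun l => l.headD d) :=
  ⟨fstF, fstF_mem_FP, fun l => by cases l <;> simp [hd]⟩

/-- Tail of a raw list. [folklore] -/
theorem rawTail (e : α → List Bool) : CodeFP (rawE e) (rawE e) List.tail :=
  ⟨sndF, sndF_mem_FP, fun l => by cases l <;> simp⟩

/-- Concatenation of raw lists is concatenation of codes. [folklore] -/
theorem rawAppend (e : α → List Bool) : CodeFP (pairE (rawE e) (rawE e)) (rawE e) (fun p => p.1 ++ p.2) :=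
  ⟨fun z => fstF z ++ sndF z, append_mem_FP fstF_mem_FP sndF_mem_FP, fun p => by
    simp [rawE_append]⟩

/-- The one-item raw list. [folklore] -/
theorem rawSingleton (e : α → List Bool) : CodeFP e (rawE e) (fun a => [a]) :=
  ⟨fanoutFn id (fun _ => []), fanoutFn_mem_FP (PolyTimeComputable.id _) (const_mem_FP _), fun a => by
    simp⟩

/-! ### Folds over raw lists with polynomially bounded accumulators -/

/-- The step wrapper capping the output at `G(|first field|)`: `capF G H v = (H v).take (G |fstF v|)`.
On the records of a genuine run the cap is inactive; on junk it bounds the growth, which is what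
the clocked-iteration lemma needs on *every* string. [folklore] -/
noncomputable def capF (G : Polynomial ℕ) (H : List Bool → List Bool) : List Bool → List Bool :=
  Plumb.takeFn ∘ fanoutFn (Plumb.polyFn G ∘ fstF) H

/-- Value of `capF`. [folklore] -/
theorem capF_apply (G : Polynomial ℕ) (H : List Bool → List Bool) (v : List Bool) :
    capF G H v = (H v).take (G.eval (fstF v).length) := by
  simp [capF]

/-- `capF G H ∈ FP` for `H ∈ FP`. [folklore] -/
theorem capF_mem_FP (G : Polynomial ℕ) {H : List Bool → List Bool} (hH : H ∈ FP) : capF G H ∈ FP :=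
  comp_mem_FP Plumb.takeFn_mem_FP
    (fanoutFn_mem_FP (comp_mem_FP (Plumb.polyFn_mem_FP G) fstF_mem_FP) hH)

/-- The cap bounds the output on every string. [folklore] -/
theorem length_capF_le (G : Polynomial ℕ) (H : List Bool → List Bool) (v : List Bool) :
    (capF G H v).length ≤ G.eval (fstF v).length := by
  rw [capF_apply, List.length_take]; exact min_le_left _ _

/-- The argument handed to a typed step: `⟨w, ⟨a, acc⟩⟩ ↦ ⟨fstF w, ⟨a, acc⟩⟩` (the context code is
the first field of the whole input `w`). [folklore] -/
noncomputable def ctxArgF : List Bool → List Bool := fanoutFn (fstF ∘ fstF) sndF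

/-- `ctxArgF ∈ FP`. [folklore] -/
theorem ctxArgF_mem_FP : ctxArgF ∈ FP := fanoutFn_mem_FP (comp_mem_FP fstF_mem_FP fstF_mem_FP) sndF_mem_FP

/-- `ctxArgF` on a record. [folklore] -/
@[simp] theorem ctxArgF_apply (w a acc : List Bool) :
    ctxArgF (boolPair w (boolPair a acc)) = boolPair (fstF w) (boolPair a acc) := by
  simp [ctxArgF]

/-- **Growth of one fold round, polynomial form**: if `|step v| ≤ G(|fstF v|)` on every string, then
`|foldRound step z| ≤ |z| + G(|fstF z|) + 4`. [folklore] -/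
theorem length_foldRound_le_poly {step : List Bool → List Bool} {G : Polynomial ℕ}
    (hle : ∀ v, (step v).length ≤ G.eval (fstF v).length) (z : List Bool) :
    (foldRound step z).length ≤ z.length + (G + 4).eval (fstF z).length := by
  have h0 := length_fstF_sndF_le z
  have h1 : 2 * (nthF 1 z).length + (sndPow 1 z).length ≤ (sndF z).length := by
    simpa using length_nthF_succ_add_sndPow_succ_le 0 z
  have h2 := length_fstF_sndF_le (nthF 1 z)
  rw [foldRound, iteFn_of_oneBit (oneBit_isNilFn.comp _)]
  split_ifs
  · rw [length_fanoutFn, length_fanoutFn]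
    simp only [nthF_zero, eval_add, eval_ofNat]
    omega
  · rw [length_fanoutFn, length_fanoutFn]
    simp only [nthF_zero, Function.comp_apply, eval_add, eval_ofNat]
    have harg : fstF (stepArg z) = fstF z := by simp [stepArg]
    have hs := hle (stepArg z)
    rw [harg] at hs
    omega

/-- **The fold brick is in `FP` for a step of polynomially bounded output** (in the first field of
its argument, i.e. in the whole input of the fold). [cite: AroraBarak2009, §1.3 (bounded loops), §1.4.1] -/
theorem foldFn_mem_FP_of_le {step ini : List Bool → List Bool} (hstep : step ∈ FP) (hini : ini ∈ FP)
    (G : Polynomial ℕ) (hle : ∀ v, (step v).length ≤ G.eval (fstF v).length) : foldFn step ini ∈ FP :=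
  comp_mem_FP (sndPow_mem_FP 1) (comp_mem_FP
    (iterate_mem_FP_of_growth_poly (foldRound_mem_FP hstep) (G + 4) (fun w => fstF_foldRound step w)
      (fun w => length_foldRound_le_poly hle w) Polynomial.X)
    (fanoutFn_mem_FP (PolyTimeComputable.id _) (fanoutFn_mem_FP sndF_mem_FP hini)))

/-- **Left folds over raw lists with a context**, for a step and an initial value computed on codes
and an accumulator whose code stays polynomially bounded in the whole input along the run.
[cite: AroraBarak2009, §1.3 (polynomial time is closed under polynomially bounded loops)] -/
theorem foldl {step : σ → α → β → β} {init : σ → β}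
    (hstep : CodeFP (pairE eσ (pairE eα eβ)) eβ (fun t => step t.1 t.2.1 t.2.2))
    (hinit : CodeFP eσ eβ init) (G : Polynomial ℕ)
    (hG : ∀ (s : σ) (l₁ l₂ : List α), (eβ (l₁.foldl (fun b a => step s a b) (init s))).length ≤
      G.eval (pairE eσ (rawE eα) (s, l₁ ++ l₂)).length) :
    CodeFP (pairE eσ (rawE eα)) eβ (fun p => p.2.foldl (fun b a => step p.1 a b) (init p.1)) := by
  obtain ⟨F, hF, hFs⟩ := hstep
  obtain ⟨I, hI, hIs⟩ := hinit
  refine ⟨foldFn (capF G (F ∘ ctxArgF)) (I ∘ fstF),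
    foldFn_mem_FP_of_le (capF_mem_FP G (comp_mem_FP hF ctxArgF_mem_FP)) (comp_mem_FP hI fstF_mem_FP) G
      (length_capF_le G _), fun p => ?_⟩
  obtain ⟨s, l⟩ := p
  rw [pairE_apply, foldFn_boolPair]
  simp only [Function.comp_apply, fstF_boolPair, decNil_rawE, hIs]
  set w := boolPair (eσ s) (rawE eα l) with hw
  set f : List α → β := fun l₁ => l₁.foldl (fun b a => step s a b) (init s) with hf
  have key : ∀ l₂ l₁ : List α, l₁ ++ l₂ = l →
      (l₂.map eα).foldl (fun acc a => capF G (F ∘ ctxArgF) (boolPair w (boolPair a acc))) (eβ (f l₁)) =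
        eβ (f l) := by
    intro l₂
    induction l₂ with
    | nil => intro l₁ h; rw [List.append_nil] at h; subst h; rfl
    | cons a l₂ ih =>
      intro l₁ h
      rw [List.map_cons, List.foldl_cons]
      have hstep : capF G (F ∘ ctxArgF) (boolPair w (boolPair (eα a) (eβ (f l₁)))) = eβ (f (l₁ ++ [a])) := by
        rw [capF_apply, fstF_boolPair, Function.comp_apply, ctxArgF_apply, hw, fstF_boolPair, ← hw]
        have h1 : F (boolPair (eσ s) (boolPair (eα a) (eβ (f l₁)))) = eβ (step s a (f l₁)) :=
          hFs (s, a, f l₁)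
        have h2 : f (l₁ ++ [a]) = step s a (f l₁) := by simp [hf]
        rw [h1, ← h2]
        apply List.take_of_length_le
        have h3 := hG s (l₁ ++ [a]) l₂
        rwa [List.append_assoc, List.singleton_append, h] at h3
      rw [hstep]
      exact ih (l₁ ++ [a]) (by rw [List.append_assoc, List.singleton_append, h])
  have := key l [] (List.nil_append l)
  simpa [hf] using this

/-- Re-targeting the output code along an identity of codes. [folklore] -/
theorem recodeOut {g : α → β} {g' : α → γ} (h : CodeFP eα eβ g) (he : ∀ a, eβ (g a) = eγ (g' a)) :
    CodeFP eα eγ g' := by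
  obtain ⟨f, hf, hfg⟩ := h
  exact ⟨f, hf, fun a => by rw [hfg, he]⟩

/-- Context-free folds. [cite: AroraBarak2009, §1.3] -/
theorem foldl₀ {step : α → β → β} {b₀ : β} (hstep : CodeFP (pairE eα eβ) eβ (fun t => step t.1 t.2))
    (G : Polynomial ℕ)
    (hG : ∀ l₁ l₂ : List α, (eβ (l₁.foldl (fun b a => step a b) b₀)).length ≤ G.eval (rawE eα (l₁ ++ l₂)).length) :
    CodeFP (rawE eα) eβ (fun l => l.foldl (fun b a => step a b) b₀) := by
  have h := foldl (σ := Unit) (eσ := fun _ => []) (step := fun _ a b => step a b) (init := fun _ => b₀)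
    (hstep.comp (snd _ _)) (const _ b₀) G (fun u l₁ l₂ => (hG l₁ l₂).trans
      (TM2Iter.eval_mono G (by simp)))
  exact h.comp ((const (rawE eα) ()).pair (CodeFP.id (rawE eα)))

/-- Counting fold. [folklore] -/
theorem foldl_succ_eq_length_add (l : List α) (k : ℕ) : l.foldl (fun k _ => k + 1) k = k + l.length := by
  induction l generalizing k with
  | nil => rfl
  | cons a l ih => rw [List.foldl_cons, ih]; simp; omega

/-- The length of a raw list, in unary. [folklore] -/
theorem ulength (eα : α → List Bool) : CodeFP (rawE eα) unE List.length := by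
  have h := foldl₀ (eα := eα) (step := fun (_ : α) (k : ℕ) => k + 1) (b₀ := 0)
    (unSucc.comp (snd eα unE)) X (fun l₁ l₂ => by
      rw [foldl_succ_eq_length_add, eval_X, length_unE, Nat.zero_add]
      exact (length_le_length_rawE eα l₁).trans (length_rawE_le_of_sublist eα (List.sublist_append_left l₁ l₂)))
  exact h.congr fun l => by rw [foldl_succ_eq_length_add, Nat.zero_add]

/-- The length of a raw list, in binary. [folklore] -/
theorem natLength (eα : α → List Bool) : CodeFP (rawE eα) natE List.length :=
  (natOfUn.comp (ulength eα)).congr fun _ => rfl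

/-- From raw lists to headed lists (prepend the unary length). [folklore] -/
theorem listOfRaw (eα : α → List Bool) : CodeFP (rawE eα) (listE eα) id :=
  ((ulength eα).pair (CodeFP.id (rawE eα))).recodeOut fun _ => rfl

/-- `|natE m| ≤ m`. [folklore] -/
theorem length_natE_le (m : ℕ) : (natE m).length ≤ m := by
  induction m with
  | zero => simp
  | succ m ih =>
    have h := length_encodeNat_succ_le m
    change (encodeNat (m + 1)).length ≤ m + 1
    change (encodeNat m).length ≤ m at ih
    omega

/-- `foldl` appending singletons is `map`. [folklore] -/
theorem foldl_append_singleton (f : α → β) (l : List α) (acc : List β) :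
    l.foldl (fun b a => b ++ [f a]) acc = acc ++ l.map f := by
  induction l generalizing acc with
  | nil => simp
  | cons a l ih => rw [List.foldl_cons, ih]; simp

/-- **`map` with a context over raw lists.** [cite: AroraBarak2009, §1.3] -/
theorem map {g : σ × α → β} (hg : CodeFP (pairE eσ eα) eβ g) :
    CodeFP (pairE eσ (rawE eα)) (rawE eβ) (fun p => p.2.map (fun a => g (p.1, a))) := by
  have hg' := hg
  obtain ⟨Gf, hGf, hGfg⟩ := hg'
  obtain ⟨P, hP⟩ := exists_poly_length_le_of_mem_FP hGf
  have hA : CodeFP (pairE eσ (pairE eα (rawE eβ))) (rawE eβ) (fun t => t.2.2) := (snd _ _).snd'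
  have hB : CodeFP (pairE eσ (pairE eα (rawE eβ))) eβ (fun t => g (t.1, t.2.1)) :=
    hg.comp₂ (fst _ _) (snd _ _).fst'
  have h := foldl (step := fun s a acc => acc ++ [g (s, a)]) (init := fun _ => ([] : List β))
    ((rawAppend eβ).comp₂ hA ((rawSingleton eβ).comp hB)) (const eσ []) (X * (2 * P + 2))
    (fun s l₁ l₂ => by
      rw [foldl_append_singleton, List.nil_append]
      set w := pairE eσ (rawE eα) (s, l₁ ++ l₂) with hw
      have hitem : ∀ a ∈ l₁ ++ l₂, 2 * (eβ (g (s, a))).length + 2 ≤ 2 * P.eval w.length + 2 := by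
        intro a ha
        have h1 : (eβ (g (s, a))).length ≤ P.eval (pairE eσ eα (s, a)).length := by
          rw [← hGfg]; exact hP _
        have h2 : (pairE eσ eα (s, a)).length ≤ w.length := by
          rw [hw, pairE_apply, pairE_apply, length_boolPair, length_boolPair]
          have := length_item_le_length_rawE eα ha
          simp only
          omega
        have := TM2Iter.eval_mono P h2
        omega
      rw [length_rawE, List.map_map]
      have hfinal : ((l₁.map (fun a => 2 * (eβ (g (s, a))).length + 2))).sum ≤
          w.length * (2 * P.eval w.length + 2) :=
        calc ((l₁.map (fun a => 2 * (eβ (g (s, a))).length + 2))).sum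
            ≤ (l₁.map (fun a => 2 * (eβ (g (s, a))).length + 2)).length • (2 * P.eval w.length + 2) :=
              List.sum_le_card_nsmul _ _ fun x hx => by
                obtain ⟨a, ha, rfl⟩ := List.mem_map.1 hx
                exact hitem a (List.mem_append_left _ ha)
          _ ≤ w.length * (2 * P.eval w.length + 2) := by
              rw [List.length_map, smul_eq_mul]
              apply Nat.mul_le_mul_right
              calc l₁.length ≤ (l₁ ++ l₂).length := by simp
                _ ≤ (rawE eα (l₁ ++ l₂)).length := length_le_length_rawE _ _
                _ ≤ w.length := by rw [hw, pairE_apply, length_boolPair]; simp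
      have heval : (X * (2 * P + 2)).eval w.length = w.length * (2 * P.eval w.length + 2) := by simp
      rw [heval]
      exact hfinal)
  exact h.congr fun p => by rw [foldl_append_singleton, List.nil_append]

/-- **`map` without a context.** [cite: AroraBarak2009, §1.3] -/
theorem map₀ {g : α → β} (hg : CodeFP eα eβ g) : CodeFP (rawE eα) (rawE eβ) (fun l => l.map g) :=
  ((map (σ := Unit) (eσ := fun _ => []) (hg.comp (snd _ eα))).comp
    ((const (rawE eα) ()).pair (CodeFP.id (rawE eα)))).congr fun _ => rfl

/-- `foldl` of `&&` is `all`. [folklore] -/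
theorem foldl_and_eq (f : α → Bool) (l : List α) (b : Bool) :
    l.foldl (fun b a => b && f a) b = (b && l.all f) := by
  induction l generalizing b with
  | nil => simp
  | cons a l ih => rw [List.foldl_cons, ih]; simp [Bool.and_assoc]

/-- **`all` with a context over raw lists.** [cite: AroraBarak2009, §1.3] -/
theorem all {p : σ × α → Bool} (hp : CodeFP (pairE eσ eα) bitE p) :
    CodeFP (pairE eσ (rawE eα)) bitE (fun q => q.2.all (fun a => p (q.1, a))) := by
  have hA : CodeFP (pairE eσ (pairE eα bitE)) bitE (fun t => t.2.2) := (snd _ _).snd'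
  have hB : CodeFP (pairE eσ (pairE eα bitE)) bitE (fun t => p (t.1, t.2.1)) :=
    hp.comp₂ (fst _ _) (snd _ _).fst'
  have h := foldl (step := fun s a b => b && p (s, a)) (init := fun _ => true)
    (hA.and hB) (const eσ true) 1 (fun s l₁ l₂ => by simp [bitE])
  exact h.congr fun q => by rw [foldl_and_eq, Bool.true_and]

/-- `any` is `¬ all ¬`. [folklore] -/
theorem not_all_not (f : α → Bool) (l : List α) : (!l.all fun a => !f a) = l.any f := by
  induction l with
  | nil => rfl
  | cons a l ih => rw [List.all_cons, List.any_cons, Bool.not_and, Bool.not_not, ih]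

/-- **`any` with a context over raw lists.** [cite: AroraBarak2009, §1.3] -/
theorem any {p : σ × α → Bool} (hp : CodeFP (pairE eσ eα) bitE p) :
    CodeFP (pairE eσ (rawE eα)) bitE (fun q => q.2.any (fun a => p (q.1, a))) :=
  (all hp.not).not.congr fun _ => not_all_not _ _

/-- **Membership in a raw list**, for an injective item code (stated with the `BEq`-based
decidability of list membership, as synthesized at concrete item types). [cite: AroraBarak2009, §1.3] -/
theorem mem [BEq α] [LawfulBEq α] (he : Function.Injective eα) :
    CodeFP (pairE eα (rawE eα)) bitE (fun p => decide (p.1 ∈ p.2)) :=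
  (any (beq he)).congr fun p => by
    rw [Bool.eq_iff_iff, List.any_eq_true]
    simp only [beq_iff_eq, decide_eq_true_eq]
    exact ⟨fun ⟨x, hx, hpx⟩ => hpx ▸ hx, fun h => ⟨_, h, rfl⟩⟩

/-- The duplicate-freeness scan. [folklore] -/
theorem foldl_nodup_aux [DecidableEq α] (l seen : List α) (ok : Bool) :
    l.foldl (fun (st : List α × Bool) a => (a :: st.1, st.2 && !decide (a ∈ st.1))) (seen, ok) =
      (l.reverse ++ seen, ok && decide (l.Nodup ∧ ∀ a ∈ l, a ∉ seen)) := by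
  induction l generalizing seen ok with
  | nil => simp
  | cons a l ih =>
    rw [List.foldl_cons, ih]
    refine Prod.ext (by simp) ?_
    simp only [List.nodup_cons, List.mem_cons, not_or, forall_eq_or_imp, Bool.and_assoc]
    congr 1
    rw [Bool.eq_iff_iff]
    simp only [Bool.and_eq_true, Bool.not_eq_true', decide_eq_false_iff_not, decide_eq_true_eq]
    constructor
    · rintro ⟨ha, hnd, hall⟩
      exact ⟨⟨fun hal => (hall a hal).1 rfl, hnd⟩, ha, fun x hx => (hall x hx).2⟩
    · rintro ⟨⟨hal, hnd⟩, ha, hall⟩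
      exact ⟨ha, hnd, fun x hx => ⟨fun hxa => hal (hxa ▸ hx), hall x hx⟩⟩

/-- **Duplicate-freeness of a raw list**, for an injective item code. [cite: AroraBarak2009, §1.3] -/
theorem nodup [DecidableEq α] (he : Function.Injective eα) :
    CodeFP (rawE eα) bitE (fun l => decide l.Nodup) := by
  have hK : CodeFP (pairE eα (pairE (rawE eα) bitE)) (pairE eα (rawE eα)) (fun t => (t.1, t.2.1)) :=
    (fst _ _).pair (snd _ _).fst'
  have hstep : CodeFP (pairE eα (pairE (rawE eα) bitE)) (pairE (rawE eα) bitE)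
      (fun t => (t.1 :: t.2.1, t.2.2 && !decide (t.1 ∈ t.2.1))) :=
    ((rawCons eα).comp hK).pair ((snd _ _).snd'.and ((mem he).comp hK).not)
  have h := foldl₀ (eα := eα) (eβ := pairE (rawE eα) bitE) (b₀ := (([] : List α), true)) hstep (2 * X + 3)
    (fun l₁ l₂ => by
    rw [foldl_nodup_aux, pairE_apply, length_boolPair, List.append_nil]
    simp only [bitE, List.length_singleton, eval_add, eval_mul, eval_ofNat, eval_X]
    have h1 : (rawE eα l₁.reverse).length = (rawE eα l₁).length := by
      rw [length_rawE, length_rawE, List.map_reverse, List.sum_reverse]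
    have h2 := length_rawE_le_of_sublist eα (List.sublist_append_left l₁ l₂)
    omega)
  exact h.snd'.congr fun l => by rw [foldl_nodup_aux]; simp

/-- `foldl` of `++` is `flatten`. [folklore] -/
theorem foldl_append_eq (l : List (List α)) (acc : List α) :
    l.foldl (fun b a => b ++ a) acc = acc ++ l.flatten := by
  induction l generalizing acc with
  | nil => simp
  | cons a l ih => rw [List.foldl_cons, ih]; simp

/-- **Flattening a raw list of raw lists.** [cite: AroraBarak2009, §1.3] -/
theorem flatten (eα : α → List Bool) : CodeFP (rawE (rawE eα)) (rawE eα) List.flatten := by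
  have h := foldl₀ (step := fun (a : List α) (b : List α) => b ++ a) (b₀ := [])
    ((rawAppend eα).comp ((snd _ _).pair (fst _ _))) X (fun l₁ l₂ => by
      rw [foldl_append_eq, List.nil_append, eval_X]
      refine le_trans ?_ (length_rawE_le_of_sublist _ (List.sublist_append_left l₁ l₂))
      induction l₁ with
      | nil => simp
      | cons a l ih =>
        rw [List.flatten_cons, rawE_append, List.length_append, rawE_cons, length_boolPair]
        omega)
  exact h.congr fun l => by rw [foldl_append_eq, List.nil_append]

/-- The bounded-range scan. [folklore] -/
theorem foldl_brange_aux (n : ℕ) (l : List α) :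
    l.foldl (fun (st : ℕ × List ℕ) _ => if st.1 < n then (st.1 + 1, st.2 ++ [st.1]) else st) (0, []) =
      (min n l.length, List.range (min n l.length)) := by
  induction l using List.reverseRecOn with
  | nil => simp
  | append_singleton l a ih =>
    rw [List.foldl_append, ih, List.foldl_cons, List.foldl_nil, List.length_append, List.length_singleton]
    by_cases h : l.length < n
    · rw [min_eq_right h.le, if_pos h, min_eq_right h, List.range_succ]
    · push Not at h
      rw [min_eq_left h, if_neg (lt_irrefl n), min_eq_left (by omega)]

/-- Size of the state of the bounded-range scan. [folklore] -/
theorem length_brangeState_le (m : ℕ) :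
    (pairE natE (rawE natE) (m, List.range m)).length ≤ 2 * m + 2 + m * (2 * m + 2) := by
  have hsum : ((List.range m).map ((fun k => 2 * (natE k).length + 2))).sum ≤ m * (2 * m + 2) := by
    calc ((List.range m).map (fun k => 2 * (natE k).length + 2)).sum
        ≤ ((List.range m).map (fun k => 2 * (natE k).length + 2)).length • (2 * m + 2) :=
          List.sum_le_card_nsmul _ _ fun x hx => by
            obtain ⟨k, hk, rfl⟩ := List.mem_map.1 hx
            have h1 := length_natE_le k
            have h2 := List.mem_range.1 hk
            omega
      _ = m * (2 * m + 2) := by rw [List.length_map, List.length_range, smul_eq_mul]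
  have h1 := length_natE_le m
  have h2 : (pairE natE (rawE natE) (m, List.range m)).length =
      2 * (natE m).length + 2 + ((List.range m).map (fun k => 2 * (natE k).length + 2)).sum := by
    rw [pairE_apply, length_boolPair, length_rawE]
  omega

/-- **Bounded range**: `(l, n) ↦ [0, …, min n |l| - 1]` (the range of a binary numeral is not
polynomial; the list `l` serves as a unary budget). [cite: AroraBarak2009, §1.3] -/
theorem brange (eα : α → List Bool) :
    CodeFP (pairE (rawE eα) natE) (rawE natE) (fun p => List.range (min p.2 p.1.length)) := by
  have hK : CodeFP (pairE natE (pairE eα (pairE natE (rawE natE)))) natE (fun t => t.2.2.1) :=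
    (snd _ _).snd'.fst'
  have hAcc : CodeFP (pairE natE (pairE eα (pairE natE (rawE natE)))) (rawE natE) (fun t => t.2.2.2) :=
    (snd _ _).snd'.snd'
  have hstep : CodeFP (pairE natE (pairE eα (pairE natE (rawE natE)))) (pairE natE (rawE natE))
      (fun t => if t.2.2.1 < t.1 then (t.2.2.1 + 1, t.2.2.2 ++ [t.2.2.1]) else t.2.2) :=
    ((natLt.comp (hK.pair (fst _ _))).ite
      ((natAdd.comp (hK.pair (const _ 1))).pair ((rawAppend natE).comp (hAcc.pair ((rawSingleton natE).comp hK))))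
      (snd _ _).snd').congr fun t => by simp only [decide_eq_true_eq]
  have h := foldl (step := fun n (_ : α) (st : ℕ × List ℕ) => if st.1 < n then (st.1 + 1, st.2 ++ [st.1]) else st)
    (init := fun _ => ((0 : ℕ), ([] : List ℕ))) hstep (const natE (0, [])) (2 * X + 2 + X * (2 * X + 2))
    (fun n l₁ l₂ => by
      rw [foldl_brange_aux]
      set m := min n l₁.length with hm
      set w := pairE natE (rawE eα) (n, l₁ ++ l₂) with hw
      have hmw : m ≤ w.length := by
        calc m ≤ l₁.length := min_le_right _ _
          _ ≤ (l₁ ++ l₂).length := by simp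
          _ ≤ (rawE eα (l₁ ++ l₂)).length := length_le_length_rawE _ _
          _ ≤ w.length := by rw [hw, pairE_apply, length_boolPair]; simp
      refine (length_brangeState_le m).trans ?_
      simp only [eval_add, eval_mul, eval_ofNat, eval_X]
      exact Nat.add_le_add (by omega) (Nat.mul_le_mul hmw (by omega)))
  exact (h.snd'.comp ((snd _ _).pair (fst _ _))).congr fun p => by simp [foldl_brange_aux]

/-- **Indexing a raw list by a binary numeral**, with a default coded by `ε`. [cite: AroraBarak2009, §1.3] -/
theorem rawGetD (eα : α → List Bool) {d : α} (hd : eα d = []) :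
    CodeFP (pairE (rawE eα) natE) eα (fun p => p.1.getD p.2 d) := by
  refine ⟨HashBricks.nthItemFn ∘ fanoutFn (binToUnaryFn ∘ fanoutFn fstF sndF) fstF,
    comp_mem_FP HashBricks.nthItemFn_mem_FP (fanoutFn_mem_FP
      (comp_mem_FP binToUnaryFn_mem_FP (fanoutFn_mem_FP fstF_mem_FP sndF_mem_FP)) fstF_mem_FP), fun p => ?_⟩
  obtain ⟨l, i⟩ := p
  have encList_eq_body : ∀ L : List (List Bool), encList L = OracleCompose.body L := by
    intro L
    induction L with
    | nil => rfl
    | cons a L ih => rw [encList_cons, OracleCompose.body_cons, ih]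
  simp only [Function.comp_apply, pairE_apply, fanoutFn_apply, fstF_boolPair, sndF_boolPair,
    binToUnaryFn_boolPair, bitsToNat_natE]
  rw [show rawE eα l = OracleCompose.body (l.map eα) from encList_eq_body _, HashBricks.nthItemFn_body]
  set m := min i (OracleCompose.body (l.map eα)).length with hm
  have hmap : (l.map eα).getD m [] = eα (l.getD m d) := by
    rw [show ([] : List Bool) = eα d from hd.symm, List.getD_map]
  rw [hmap]
  have hl : l.length ≤ (OracleCompose.body (l.map eα)).length := by
    rw [← encList_eq_body]; exact length_le_length_rawE eα l
  by_cases hi : i < l.length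
  · rw [hm, min_eq_left (hi.le.trans hl)]
  · push Not at hi
    rw [List.getD_eq_default _ _ hi, List.getD_eq_default _ _ (le_min hi hl)]

/-- `n ≤ 1ᵏ` for binary `n` and unary `k`. [folklore] -/
theorem natLeUn : CodeFP (pairE natE unE) bitE (fun p => decide (p.1 ≤ p.2)) :=
  (unLeNat.comp ((unSucc.comp (snd natE unE)).pair (fst natE unE))).not.congr fun p => by
    by_cases h : p.1 ≤ p.2
    · simp [h]
    · simp [h]
      omega

/-- **Case analysis on a raw list** (empty / head and tail), the cons case reading the same code.
[folklore] -/
theorem rawCases {k : σ → List α → δ} {gnil : σ → δ} {gcons : σ × α × List α → δ}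
    (hnil : CodeFP eσ eδ gnil) (hcons : CodeFP (pairE eσ (pairE eα (rawE eα))) eδ gcons)
    (hk0 : ∀ s, k s [] = gnil s) (hk1 : ∀ s a l, k s (a :: l) = gcons (s, a, l)) :
    CodeFP (pairE eσ (rawE eα)) eδ (fun p => k p.1 p.2) := by
  obtain ⟨N, hN, hNg⟩ := hnil
  obtain ⟨C, hC, hCg⟩ := hcons
  refine ⟨iteFn (isNilFn ∘ sndF) (N ∘ fstF) C,
    iteFn_mem_FP (comp_mem_FP isNilFn_mem_FP sndF_mem_FP) (comp_mem_FP hN fstF_mem_FP) hC, fun p => ?_⟩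
  obtain ⟨s, l⟩ := p
  cases l with
  | nil =>
    rw [iteFn_apply (b := true) (by simp [isNilFn])]
    simp [hNg, hk0]
  | cons a l =>
    have hne : boolPair (eα a) (rawE eα l) ≠ [] := fun h => by simpa using congrArg List.length h
    rw [iteFn_apply (b := false) (by simp [isNilFn, hne])]
    simpa [hk1] using hCg (s, a, l)

/-- The step of the `zipWith` scan: consume one item of the second list. [folklore] -/
def zipStep (g : σ × α × β → γ) (s : σ) (a : α) (st : List β × List γ) : List β × List γ :=
  match st.1 with
  | [] => ([], st.2)
  | b :: rem => (rem, st.2 ++ [g (s, a, b)])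

/-- **Semantics of the `zipWith` scan**: the second list is consumed item by item and the outputs
accumulate `zipWith`. [folklore] -/
theorem foldl_zipStep (g : σ × α × β → γ) (s : σ) (l₁ : List α) (rem : List β) (out : List γ) :
    l₁.foldl (fun st a => zipStep g s a st) (rem, out) =
      (rem.drop l₁.length, out ++ List.zipWith (fun a b => g (s, a, b)) l₁ rem) := by
  induction l₁ generalizing rem out with
  | nil => simp
  | cons a l₁ ih =>
    cases rem with
    | nil =>
      rw [List.foldl_cons, show zipStep g s a (([] : List β), out) = ([], out) from rfl, ih]
      simp
    | cons b rem =>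
      rw [List.foldl_cons, show zipStep g s a (b :: rem, out) = (rem, out ++ [g (s, a, b)]) from rfl, ih]
      simp

/-- Items of a `zipWith` come from items of the two lists. [folklore] -/
theorem exists_of_mem_zipWith {f : α → β → γ} {x : γ} :
    ∀ {l : List α} {l' : List β}, x ∈ List.zipWith f l l' → ∃ a ∈ l, ∃ b ∈ l', x = f a b
  | [], _, h => by simp at h
  | _ :: _, [], h => by simp at h
  | a :: l, b :: l', h => by
    rw [List.zipWith_cons_cons, List.mem_cons] at h
    rcases h with rfl | h
    · exact ⟨a, by simp, b, by simp, rfl⟩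
    · obtain ⟨a', ha', b', hb', rfl⟩ := exists_of_mem_zipWith h
      exact ⟨a', List.mem_cons_of_mem _ ha', b', List.mem_cons_of_mem _ hb', rfl⟩

/-- **`zipWith` with a context over raw lists.** [cite: AroraBarak2009, §1.3] -/
theorem zipWith {g : σ × α × β → γ} (hg : CodeFP (pairE eσ (pairE eα eβ)) eγ g) :
    CodeFP (pairE eσ (pairE (rawE eα) (rawE eβ))) (rawE eγ)
      (fun p => List.zipWith (fun a b => g (p.1, a, b)) p.2.1 p.2.2) := by
  have hg' := hg
  obtain ⟨Gf, hGf, hGfg⟩ := hg'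
  obtain ⟨P, hP⟩ := exists_poly_length_le_of_mem_FP hGf
  -- contexts `σ' = σ × List β`, states `List β × List γ`
  let σ'E : σ × List β → List Bool := pairE eσ (rawE eβ)
  let stE : List β × List γ → List Bool := pairE (rawE eβ) (rawE eγ)
  -- the step, through `rawCases` on the remaining second list with context `((s, a), out)`
  let cE : (σ × α) × List γ → List Bool := pairE (pairE eσ eα) (rawE eγ)
  have hnil : CodeFP cE stE (fun c => (([] : List β), c.2)) := (const cE ([] : List β)).pair (snd _ _)
  have hcons : CodeFP (pairE cE (pairE eβ (rawE eβ))) stE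
      (fun t => (t.2.2, t.1.2 ++ [g (t.1.1.1, t.1.1.2, t.2.1)])) :=
    (snd _ _).snd'.pair ((rawAppend eγ).comp ((fst _ _).snd'.pair ((rawSingleton eγ).comp
      (hg.comp ((fst _ _).fst'.fst'.pair ((fst _ _).fst'.snd'.pair (snd _ _).fst'))))))
  have hcase := rawCases (k := fun (c : (σ × α) × List γ) (rem : List β) => zipStep g c.1.1 c.1.2 (rem, c.2))
    hnil hcons (fun c => rfl) (fun c b rem => rfl)
  have hstep : CodeFP (pairE σ'E (pairE eα stE)) stE (fun t => zipStep g t.1.1 t.2.1 t.2.2) :=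
    (hcase.comp ((((fst _ _).fst'.pair (snd _ _).fst').pair (snd _ _).snd'.snd').pair
      (snd _ _).snd'.fst')).congr fun t => rfl
  have hinit : CodeFP σ'E stE (fun c => (c.2, ([] : List γ))) := (snd _ _).pair (const σ'E ([] : List γ))
  have h := foldl (step := fun (c : σ × List β) a st => zipStep g c.1 a st) (init := fun c => (c.2, ([] : List γ)))
    hstep hinit (2 * X + 2 + X * (2 * P + 2)) (fun c l₁ l₂ => by
      obtain ⟨s, m⟩ := c
      rw [foldl_zipStep, List.nil_append]
      set w := pairE σ'E (rawE eα) ((s, m), l₁ ++ l₂) with hw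
      have hwlen : w.length = 2 * (2 * (eσ s).length + 2 + (rawE eβ m).length) + 2 + (rawE eα (l₁ ++ l₂)).length := by
        rw [hw, pairE_apply, length_boolPair]
        simp only [σ'E, pairE_apply, length_boolPair]
      have hrem : (rawE eβ (m.drop l₁.length)).length ≤ w.length :=
        (length_rawE_le_of_sublist eβ (List.drop_sublist _ _)).trans (by omega)
      have hitem : ∀ x ∈ List.zipWith (fun a b => g (s, a, b)) l₁ m,
          2 * (eγ x).length + 2 ≤ 2 * P.eval w.length + 2 := by
        intro x hx
        obtain ⟨a, ha, b, hb, rfl⟩ := exists_of_mem_zipWith hx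
        have h1 : (eγ (g (s, a, b))).length ≤ P.eval (pairE eσ (pairE eα eβ) (s, a, b)).length := by
          rw [← hGfg]; exact hP _
        have h2 : (pairE eσ (pairE eα eβ) (s, a, b)).length ≤ w.length := by
          have ha' := length_item_le_length_rawE eα (List.mem_append_left l₂ ha)
          have hb' := length_item_le_length_rawE eβ hb
          simp only [pairE_apply, length_boolPair]
          omega
        have := TM2Iter.eval_mono P h2
        omega
      have hout : (rawE eγ (List.zipWith (fun a b => g (s, a, b)) l₁ m)).length ≤ w.length * (2 * P.eval w.length + 2) := by
        rw [length_rawE]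
        calc ((List.zipWith (fun a b => g (s, a, b)) l₁ m).map (fun x => 2 * (eγ x).length + 2)).sum
            ≤ ((List.zipWith (fun a b => g (s, a, b)) l₁ m).map (fun x => 2 * (eγ x).length + 2)).length •
                (2 * P.eval w.length + 2) :=
              List.sum_le_card_nsmul _ _ fun y hy => by
                obtain ⟨x, hx, rfl⟩ := List.mem_map.1 hy
                exact hitem x hx
          _ ≤ w.length * (2 * P.eval w.length + 2) := by
              rw [List.length_map, List.length_zipWith, smul_eq_mul]
              apply Nat.mul_le_mul_right
              calc min l₁.length m.length ≤ l₁.length := min_le_left _ _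
                _ ≤ (l₁ ++ l₂).length := by simp
                _ ≤ (rawE eα (l₁ ++ l₂)).length := length_le_length_rawE _ _
                _ ≤ w.length := by omega
      have heval : (2 * X + 2 + X * (2 * P + 2)).eval w.length =
          2 * w.length + 2 + w.length * (2 * P.eval w.length + 2) := by simp
      rw [heval]
      simp only [stE, pairE_apply, length_boolPair]
      omega)
  refine (h.snd'.comp (((fst _ _).pair (snd _ _).snd').pair (snd _ _).fst')).congr fun p => ?_
  simp [foldl_zipStep]

end CodeFP

end Literature.Computability.Complexity
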